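import Summits.QuantumFields.YangMills.Theorems.BalabanUVNodesN20HellingerRoadNullClasses
import Summits.QuantumFields.YangMills.Theorems.BalabanUVNodesN20StubTwoTextVOfKeyedHybridCertificate
import Summits.QuantumFields.YangMills.Theorems.BalabanUVNodesN20AtRecord13CoPH

/-!
# BalabanUVNodes ∕ node N20 (NE7b) — THE HELLINGER ROAD KEYED PER TUPLE AT THE READING OF RECORD: its structural letters are THEOREMS there (non-negativity,
# positive totals, the E1∕E2 dictionary under the keyed live line); its per-tuple endpoint letters (source-differentiability, a two-sided live key, (H), (R′),
# (R‑c) ∕ bounded current) produce dag-n20-w3's 13U certificate socket `hH`, hence K3⁸ v6 stub 2's TEXT, hence K3⁸ BY NAME modulo stub 1's text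

Cell `pub-ymgap` (HUMAN RULING D-0062 Track A ∕ director-ym R399 (3a) width seats), WIDTH SEAT `pub-ymgap-dag-n20-w5` (node n20 = NE7b), generation g6,
CLAIM-3 ∕ INTENT-3 (bus; the (t3) word of dag-n20-w3 g8 ■ «your `∃ shells, HybridNE7 … ∅ 0 …` outputs are 13U's `hH` once keyed per guarded admissible tuple»).
Key item K3⁸ `SpineGivenEndpointR13SepCoPHV` (stmt-QuantumFields-27366; skeleton of record v6 b4e55110ab73e679, stub `stub_expansion13HV`), K3⁷ stmt-QuantumFields-20544
aside; filed `--kind proof --supports … --as helper`.  COUNT-NEUTRAL.  THEOREMS ONLY (0 `def`, 0 `instance`, 0 `notation`, 0 `sorry`).  ADDITIVE — imports this seat's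
`…N20HellingerRoadNullClasses` (g6 CLAIM-2: the endpoint road for NON-NEGATIVE class weights), dag-n20-w3's 13U `…N20StubTwoTextVOfKeyedHybridCertificate` (p637589:
`stubExpansion13HVText_of_keyedHybridNE7NoBad_of_liveLine`, `spineGivenEndpointR13SepCoPHV_of_stubRates13HVText_of_keyedHybridNE7NoBad_of_liveLine`) and dag-n20-e's
`…N20AtRecord13CoPH` (`schemeZ_pos_datumOfRecord₁₃CoPH`); uses dag-n20-d's `schemeZ_eq_sum_classSet_weightA ∕ …_succ_…_weightB` (p587226 lineage), n21's
`weightA₁₃_nonneg ∕ weightB₁₃_nonneg ∕ zeta_nonneg_of_provisos₁₃CoPH`, node00-def-K0c's `localBgMeasurable` — all BY NAME; modifies nothing.  Inside the theses cone (via 13U ∕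
`K3V6Defs`) like 13T ∕ 13U.

WHY.  Every positive road of the N19′∕N20∕N21 width lanes ends in `∃ shA shB …, HybridNE7 l₀ vol T A B ∅ 0 shA shB Wsh δ` at ABSTRACT carriers; 13U typed the socket
that turns such a certificate PER GUARDED ADMISSIBLE TUPLE at the record's carriers `(1, F.side⁴, classSet₁₃ θ 0 g₀, weightA₁₃ θ hP 0 g₀ os, weightB₁₃ θ hP 0 g₀ os)` into
K3⁸ v6 stub 2's text (+ the keyed live line), and K3⁸ by name modulo stub 1's text.  This file keys THIS SEAT's hellinger road there.  Two facts decide the shape: (i) the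
road of record asked STRICT positivity of both runs' class weights on the whole class set, which is structurally false at the record off the flow agreement (one-sided
σ-keys carry weight `≡ 0` under one run — dag-n20-w3 module 10); CLAIM-2 removed it (Fermat's null rule), leaving the necessary head «a two-sided live key at every
step and source»; (ii) the road's OTHER structural letters are THEOREMS at the record: `0 ≤ weightA₁₃ ∕ weightB₁₃` at every source (n21), and — under the keyed live line
`LiveSel ∧ ZetaMeasurable` that 13U already displays — the E1∕E2 dictionary `schemeZ (…) os (0+K) t = Σ weightA₁₃ K t`, `schemeZ (…) os (0+K+1) t = Σ weightB₁₃ K t`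
(dag-n20-d) with positive left sides (dag-n20-e), hence positive totals.  What remains displayed per tuple is EXACTLY the analytic content: derivative carriers of the class
weights of record on `|t| ≤ 1`, a two-sided live key per `(K, t)`, (H) with `Σ√η < ∞`, (R′) with `Σ R₁ < ∞`, and (R‑c) (or a bounded run-A current).
* §1 `dictionary_of_liveLine` (E1∕E2 at the record's carriers for EVERY `g₀, os, K, t`, from `LiveSel ∧ ZetaMeasurable`) · `totals_pos_of_liveLine` · `weights_nonneg`.
* §2 ★★★ `keyedHybridNE7NoBad_of_endpointLettersKeyed_of_liveLine` — per guarded admissible tuple and `(g₀, os)` the five endpoint letters ⇒ 13U's `hH` (CLAIM-2's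
  `exists_hybridNE7_of_affinityDefectLetter_and_response_of_nonneg` at `l₀ := 1`, `vol := F.side⁴`, §1 discharging the rest) · ★★ `…_boundedCurrentKeyed_…` twin ·
  ★ `twoSidedKeyed_of_keyedHybridNE7NoBad_of_liveLine` ((L) is NECESSARY at the record: any certificate in 13U's socket + the keyed live line forces it).
* §3 ★★★ `stubExpansion13HVText_of_endpointLettersKeyed_of_liveLine` (K3⁸ v6 STUB 2's TEXT, 13U BY NAME) · ★★
  `spineGivenEndpointR13SepCoPHV_of_stubRates13HVText_of_endpointLettersKeyed_of_liveLine` (⊢ the item `Theses.BalabanUVNodes.SpineGivenEndpointR13SepCoPHV` BY NAME modulo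
  stub 1's v6 text — audit `proof.conditional`, credits nothing) · the bounded-current twins.
READING (located, nothing proposed).  After this file the hellinger road's bill at the record is a list of FIVE per-tuple analytic letters on the class weights OF RECORD
(no abstract carrier, no modelling letter, no positivity letter): (D) source-differentiability on `|t| ≤ 1`; (L) a two-sided live σ-key at every `(K, t)` (fails only where
the two class laws are mutually singular — then no certificate exists, p607565); (H) the affinity-defect rate; (R′) the two-run first-moment letter; (R‑c) or a bounded
run-A current.  (H) has this seat's ∕ dag-n19-w4's suppliers at abstract carriers (refresh ∕ cover ∕ tame-tilt roads) — keying THEM needs the record's wild sets and tilts,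
i.e. NODE O's objects; (R′) is the two-run content, UNPRINTED for d = 4.

HONEST FRAMING.  By-name plumbing + [folklore] through CLAIM-2 and 13U on the tree's SHAPES; proves NO estimate; the five per-tuple letters, the keyed live line and stub 1's
text are HYPOTHESES inhabited for no tuple (K0⁷ `Record13SepCoPHInhabited` OPEN) and produced by nobody; NOT a proof of `stub_expansion13HV` nor of K3⁸; NOT a refutation;
nothing of Bałaban's asserted; NE7 ∕ NE7b ∕ NE7c NOT PRINTED as two-run statements for d = 4, NOT proved; N19′ ∕ N20 ∕ N21 ∕ N27x NOT discharged; K3⁸ OPEN (v6 STANDS),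
K3⁷ aside, neither claimed; no summit statement is proved by this seat; counts UNMOVED (typed 28∕28 · discharged 5∕28; 5∕27 excl. NODE O).  One finite `𝕋⁴_{L^K}`
programme at fixed ε, Bałaban AS PRINTED — R4 closes the conditional finite-𝕋⁴ rung `BalabanLadder.UV` only; NOT ℝ⁴, NOT continuum, NOT OS, NOT a mass gap, NOT Clay.
0 `def`; 0 `sorry`; standard axioms; no cite tags.
-/

noncomputable section

open Finset
open scoped BigOperators

namespace Summit.QuantumFields.YangMills.BalabanUVNodes.N20HellingerRoadKeyedAtRecord

open Literature.MathematicalPhysics.QuantumFieldTheory.Balaban1983to89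
open Literature.MathematicalPhysics.QuantumFieldTheory.Balaban1983to89.T4Continuum
open Literature.MathematicalPhysics.QuantumFieldTheory.Balaban1983to89.Node00
open T4MatchingAssembly (HybridNE7)
open Summit.QuantumFields.BalabanUV.T4Continuum.Spine
open YMDAG.UVSplit hiding SU
open Summit.QuantumFields.YangMills.Theorems.K3V5Defs (SpineReading RateReadingFn RunSel LetterReading CutReading rrOfRecord GuardedReadingN16
  KeyedRelWeight KeyedShellWeight LiveSel PinnedAtLive)
open Summit.QuantumFields.YangMills.Theorems.K3V6Defs (KeyedRatesHolderD4V KeyedCoreEdgeHolderD4V KeyedExtractionV)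
open Summit.QuantumFields.YangMills.Theorems.N20AtRecord13 (schemeZ_pos_datumOfRecord₁₃CoPH)
open Summit.QuantumFields.YangMills.BalabanUVNodes.N21KeyedShellWeightShellZero (zeta_nonneg_of_provisos₁₃CoPH weightA₁₃_nonneg weightB₁₃_nonneg)
open Summit.QuantumFields.YangMills.BalabanUVNodes.N20HellingerRoadNullClasses
  (twoSided_of_hybridNE7 exists_hybridNE7_of_affinityDefectLetter_and_response_of_nonneg exists_hybridNE7_of_affinityDefectLetter_response_boundedCurrent_of_nonneg)
open Summit.QuantumFields.YangMills.BalabanUVNodes.N20StubTwoTextVOfKeyedHybridCertificate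
  (stubExpansion13HVText_of_keyedHybridNE7NoBad_of_liveLine spineGivenEndpointR13SepCoPHV_of_stubRates13HVText_of_keyedHybridNE7NoBad_of_liveLine)

variable {F : T4Family}

/-! ## §1 The road's structural letters are THEOREMS at the record -/

section Structural

variable (θ : Stage13HParams F 2) (hP : θ.Provisos₁₃CoPH F 2)

/-- **THE E1∕E2 DICTIONARY AT THE RECORD's CARRIERS, FROM THE KEYED LIVE LINE** — `schemeZ ((datumOfRecord₁₃CoPH F 2 θ hP).scheme g₀) os (0+K) t = Σ_{classSet₁₃} weightA₁₃ K t`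
and `… (0+K+1) t = Σ_{classSet₁₃} weightB₁₃ K t` for EVERY `g₀, os, K, t` (dag-n20-d's `schemeZ_eq_sum_classSet_weightA ∕ …_succ_…_weightB` at `E := EOfRecord₁₃`, with (H‑U)
absolute and `0 ≤ ζ` from the provisos).  The `hZA' ∕ hZB'` letters of the road with `Z K t := schemeZ (…) os (0+K) t`. [bookkeeping] -/
theorem dictionary_of_liveLine (hlv : LiveSel F θ ∧ ZetaMeasurable F 2 θ.ζ) (g₀ : ℕ → ℝ) (os : List (ULoop F)) (K : ℕ) (t : ℝ) :
    T4GenFunBounds.schemeZ ((datumOfRecord₁₃CoPH F 2 θ hP).scheme g₀) os (0 + K) t = ∑ x ∈ classSet₁₃ θ 0 g₀ K, weightA₁₃ θ hP 0 g₀ os K t x ∧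
      T4GenFunBounds.schemeZ ((datumOfRecord₁₃CoPH F 2 θ hP).scheme g₀) os (0 + K + 1) t = ∑ x ∈ classSet₁₃ θ 0 g₀ K, weightB₁₃ θ hP 0 g₀ os K t x :=
  ⟨schemeZ_eq_sum_classSet_weightA 0 θ hP (EOfRecord₁₃ F 2 θ.toStage13Params) hlv.1 (localBgMeasurable F 2 θ.ν) hlv.2 (zeta_nonneg_of_provisos₁₃CoPH F θ hP) g₀ os K t,
    schemeZ_succ_eq_sum_classSet_weightB 0 θ hP (EOfRecord₁₃ F 2 θ.toStage13Params) hlv.1 (localBgMeasurable F 2 θ.ν) hlv.2 (zeta_nonneg_of_provisos₁₃CoPH F θ hP)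
      g₀ os K t⟩

/-- **POSITIVE TOTALS AT THE RECORD, FROM THE KEYED LIVE LINE** — both runs' class-weight totals over `classSet₁₃` are positive at every `K, t` (the dictionary + dag-n20-e's
`schemeZ_pos_datumOfRecord₁₃CoPH`).  The `hZA ∕ hZB` letters of the road. [bookkeeping] -/
theorem totals_pos_of_liveLine (hlv : LiveSel F θ ∧ ZetaMeasurable F 2 θ.ζ) (g₀ : ℕ → ℝ) (os : List (ULoop F)) (K : ℕ) (t : ℝ) :
    0 < ∑ x ∈ classSet₁₃ θ 0 g₀ K, weightA₁₃ θ hP 0 g₀ os K t x ∧ 0 < ∑ x ∈ classSet₁₃ θ 0 g₀ K, weightB₁₃ θ hP 0 g₀ os K t x := by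
  obtain ⟨hA, hB⟩ := dictionary_of_liveLine θ hP hlv g₀ os K t
  exact ⟨hA ▸ schemeZ_pos_datumOfRecord₁₃CoPH θ hP g₀ os (0 + K) t, hB ▸ schemeZ_pos_datumOfRecord₁₃CoPH θ hP g₀ os (0 + K + 1) t⟩

/-- **NON-NEGATIVE CLASS WEIGHTS AT EVERY SOURCE** (n21's `weightA₁₃_nonneg ∕ weightB₁₃_nonneg` on the class set).  The `hA0 ∕ hB0` letters of the road. [bookkeeping] -/
theorem weights_nonneg (g₀ : ℕ → ℝ) (os : List (ULoop F)) :
    (∀ (K : ℕ) (t : ℝ), ∀ x ∈ classSet₁₃ θ 0 g₀ K, 0 ≤ weightA₁₃ θ hP 0 g₀ os K t x) ∧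
      ∀ (K : ℕ) (t : ℝ), ∀ x ∈ classSet₁₃ θ 0 g₀ K, 0 ≤ weightB₁₃ θ hP 0 g₀ os K t x :=
  ⟨fun K t x _ => weightA₁₃_nonneg F θ hP 0 g₀ os K t x, fun K t x _ => weightB₁₃_nonneg F θ hP 0 g₀ os K t x⟩

end Structural

/-! ## §2 The per-tuple endpoint letters produce 13U's certificate socket -/

section Socket

/-- **★★★ THE HELLINGER ROAD KEYED PER TUPLE: FIVE ENDPOINT LETTERS ⇒ A NO-BAD-CLASS HYBRID CERTIFICATE AT THE RECORD's CARRIERS** (13U's `hH`).  Hypotheses: the keyed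
live line `LiveSel ∧ ZetaMeasurable` (as in 13U); and `hE` — at every guarded admissible Stage-13 tuple and every `(g₀, os)`: derivative carriers `A', B'` of the class weights
OF RECORD on `|t| ≤ 1` (D), a two-sided live σ-key at every `(K, t)` (L), (H) `1 − Σ√(pq) ≤ η_K` with `η ≥ 0`, `Σ√η < ∞`, (R′) `|Σ q·(B'∕B − A'∕A)| ≤ R₁ K` with
`Σ R₁ < ∞`, (R‑c) `Σ ½(p+q)(A'∕A − m)² ≤ χ`.  Conclusion: per tuple SOME `shA shB Wsh δ` with `HybridNE7 1 (F.side⁴) (classSet₁₃ θ 0 g₀) (weightA₁₃ …) (weightB₁₃ …) ∅ 0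
shA shB Wsh δ` — CLAIM-2's road at `l₀ := 1`, `vol := F.side⁴`, with §1 discharging non-negativity, totals and the dictionary.  `hE` is the two-run CONTENT: a HYPOTHESIS.
[bookkeeping] -/
theorem keyedHybridNE7NoBad_of_endpointLettersKeyed_of_liveLine
    (hlive : ∀ (F : T4Family) (θ : Stage13HParams F 2), θ.Provisos₁₃CoPH F 2 → (θ.ZhUnity F 2 ∧ θ.SlotsNondegenerate₁₃ F 2) → θ.Admissible F 2 →
      LiveSel F θ ∧ ZetaMeasurable F 2 θ.ζ)
    (hE : ∀ (F : T4Family) (θ : Stage13HParams F 2) (hP : θ.Provisos₁₃CoPH F 2), (θ.ZhUnity F 2 ∧ θ.SlotsNondegenerate₁₃ F 2) → θ.Admissible F 2 →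
      ∀ (g₀ : ℕ → ℝ) (os : List (ULoop F)),
        ∃ (A' B' : ℕ → ℝ → (Σ K, SiteSeqKey F (0 + K)) → ℝ) (η R₁ : ℕ → ℝ) (χ : ℝ) (m : ℕ → ℝ → ℝ),
          (∀ (K : ℕ) (s : ℝ), |s| ≤ 1 → ∀ x ∈ classSet₁₃ θ 0 g₀ K, HasDerivAt (fun u => weightA₁₃ θ hP 0 g₀ os K u x) (A' K s x) s) ∧
          (∀ (K : ℕ) (s : ℝ), |s| ≤ 1 → ∀ x ∈ classSet₁₃ θ 0 g₀ K, HasDerivAt (fun u => weightB₁₃ θ hP 0 g₀ os K u x) (B' K s x) s) ∧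
          (∀ (K : ℕ) (t : ℝ), |t| ≤ 1 → ∃ x ∈ classSet₁₃ θ 0 g₀ K, 0 < weightA₁₃ θ hP 0 g₀ os K t x ∧ 0 < weightB₁₃ θ hP 0 g₀ os K t x) ∧
          (∀ K, 0 ≤ η K) ∧ Summable (fun K => Real.sqrt (η K)) ∧
          (∀ (K : ℕ) (t : ℝ), |t| ≤ 1 →
            1 - ∑ x ∈ classSet₁₃ θ 0 g₀ K, Real.sqrt ((weightA₁₃ θ hP 0 g₀ os K t x / ∑ y ∈ classSet₁₃ θ 0 g₀ K, weightA₁₃ θ hP 0 g₀ os K t y)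
              * (weightB₁₃ θ hP 0 g₀ os K t x / ∑ y ∈ classSet₁₃ θ 0 g₀ K, weightB₁₃ θ hP 0 g₀ os K t y)) ≤ η K) ∧
          (∀ (K : ℕ) (s : ℝ), |s| ≤ 1 →
            |∑ x ∈ classSet₁₃ θ 0 g₀ K, weightB₁₃ θ hP 0 g₀ os K s x / (∑ y ∈ classSet₁₃ θ 0 g₀ K, weightB₁₃ θ hP 0 g₀ os K s y)
              * (B' K s x / weightB₁₃ θ hP 0 g₀ os K s x - A' K s x / weightA₁₃ θ hP 0 g₀ os K s x)| ≤ R₁ K) ∧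
          Summable R₁ ∧
          (∀ (K : ℕ) (s : ℝ), |s| ≤ 1 →
            ∑ x ∈ classSet₁₃ θ 0 g₀ K, (weightA₁₃ θ hP 0 g₀ os K s x / (∑ y ∈ classSet₁₃ θ 0 g₀ K, weightA₁₃ θ hP 0 g₀ os K s y)
              + weightB₁₃ θ hP 0 g₀ os K s x / (∑ y ∈ classSet₁₃ θ 0 g₀ K, weightB₁₃ θ hP 0 g₀ os K s y)) / 2
              * (A' K s x / weightA₁₃ θ hP 0 g₀ os K s x - m K s) ^ 2 ≤ χ)) :
    ∀ (F : T4Family) (θ : Stage13HParams F 2) (hP : θ.Provisos₁₃CoPH F 2), (θ.ZhUnity F 2 ∧ θ.SlotsNondegenerate₁₃ F 2) → θ.Admissible F 2 →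
      ∀ (g₀ : ℕ → ℝ) (os : List (ULoop F)),
        letI : DecidableEq (Σ K, SiteSeqKey F (0 + K)) := Classical.decEq _
        ∃ (shA shB : ℕ → ℝ → (Σ K, SiteSeqKey F (0 + K)) → ℝ) (Wsh δ : ℕ → ℝ),
          HybridNE7 1 (F.side ^ 4) (classSet₁₃ θ 0 g₀) (weightA₁₃ θ hP 0 g₀ os) (weightB₁₃ θ hP 0 g₀ os) (fun _ _ => ∅) (fun _ => 0) shA shB Wsh δ := by
  intro F θ hP hG hθ g₀ os
  letI : DecidableEq (Σ K, SiteSeqKey F (0 + K)) := Classical.decEq _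
  obtain ⟨A', B', η, R₁, χ, m, hdA, hdB, hlv2, hη0, hηs, hH, hR, hRs, hχ⟩ := hE F θ hP hG hθ g₀ os
  have hlv := hlive F θ hP hG hθ
  obtain ⟨hA0, hB0⟩ := weights_nonneg θ hP g₀ os
  have hZ := dictionary_of_liveLine θ hP hlv g₀ os
  obtain ⟨η', Wsh, shA, shB, -, -, -, hNE7⟩ :=
    exists_hybridNE7_of_affinityDefectLetter_and_response_of_nonneg (l₀ := 1) (vol := F.side ^ 4)
      (T := classSet₁₃ θ 0 g₀) (A := weightA₁₃ θ hP 0 g₀ os) (B := weightB₁₃ θ hP 0 g₀ os)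
      (Z := fun K t => T4GenFunBounds.schemeZ ((datumOfRecord₁₃CoPH F 2 θ hP).scheme g₀) os (0 + K) t)
      zero_le_one (pow_pos F.side_pos 4) hA0 hB0 hlv2 (fun K t _ => (hZ K t).1) (fun K t _ => (hZ K t).2) hdA hdB
      ⟨η, hη0, hηs, hH⟩ hR hRs hχ
  exact ⟨shA, shB, Wsh, _, hNE7⟩

/-- **★★ … WITH A BOUNDED RUN-A CURRENT IN PLACE OF (R‑c)** — the same socket from (D), (L), (H), (R′) and `|A' K s x| ≤ M·weightA₁₃ K s x` on the class set (`0 ≤ M`),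
through CLAIM-2's `exists_hybridNE7_of_affinityDefectLetter_response_boundedCurrent_of_nonneg`.  `hE` is a HYPOTHESIS. [bookkeeping] -/
theorem keyedHybridNE7NoBad_of_endpointLettersBoundedCurrentKeyed_of_liveLine
    (hlive : ∀ (F : T4Family) (θ : Stage13HParams F 2), θ.Provisos₁₃CoPH F 2 → (θ.ZhUnity F 2 ∧ θ.SlotsNondegenerate₁₃ F 2) → θ.Admissible F 2 →
      LiveSel F θ ∧ ZetaMeasurable F 2 θ.ζ)
    (hE : ∀ (F : T4Family) (θ : Stage13HParams F 2) (hP : θ.Provisos₁₃CoPH F 2), (θ.ZhUnity F 2 ∧ θ.SlotsNondegenerate₁₃ F 2) → θ.Admissible F 2 →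
      ∀ (g₀ : ℕ → ℝ) (os : List (ULoop F)),
        ∃ (A' B' : ℕ → ℝ → (Σ K, SiteSeqKey F (0 + K)) → ℝ) (η R₁ : ℕ → ℝ) (M : ℝ),
          (∀ (K : ℕ) (s : ℝ), |s| ≤ 1 → ∀ x ∈ classSet₁₃ θ 0 g₀ K, HasDerivAt (fun u => weightA₁₃ θ hP 0 g₀ os K u x) (A' K s x) s) ∧
          (∀ (K : ℕ) (s : ℝ), |s| ≤ 1 → ∀ x ∈ classSet₁₃ θ 0 g₀ K, HasDerivAt (fun u => weightB₁₃ θ hP 0 g₀ os K u x) (B' K s x) s) ∧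
          (∀ (K : ℕ) (t : ℝ), |t| ≤ 1 → ∃ x ∈ classSet₁₃ θ 0 g₀ K, 0 < weightA₁₃ θ hP 0 g₀ os K t x ∧ 0 < weightB₁₃ θ hP 0 g₀ os K t x) ∧
          (∀ K, 0 ≤ η K) ∧ Summable (fun K => Real.sqrt (η K)) ∧
          (∀ (K : ℕ) (t : ℝ), |t| ≤ 1 →
            1 - ∑ x ∈ classSet₁₃ θ 0 g₀ K, Real.sqrt ((weightA₁₃ θ hP 0 g₀ os K t x / ∑ y ∈ classSet₁₃ θ 0 g₀ K, weightA₁₃ θ hP 0 g₀ os K t y)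
              * (weightB₁₃ θ hP 0 g₀ os K t x / ∑ y ∈ classSet₁₃ θ 0 g₀ K, weightB₁₃ θ hP 0 g₀ os K t y)) ≤ η K) ∧
          (∀ (K : ℕ) (s : ℝ), |s| ≤ 1 →
            |∑ x ∈ classSet₁₃ θ 0 g₀ K, weightB₁₃ θ hP 0 g₀ os K s x / (∑ y ∈ classSet₁₃ θ 0 g₀ K, weightB₁₃ θ hP 0 g₀ os K s y)
              * (B' K s x / weightB₁₃ θ hP 0 g₀ os K s x - A' K s x / weightA₁₃ θ hP 0 g₀ os K s x)| ≤ R₁ K) ∧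
          Summable R₁ ∧ 0 ≤ M ∧
          (∀ (K : ℕ) (s : ℝ), |s| ≤ 1 → ∀ x ∈ classSet₁₃ θ 0 g₀ K, |A' K s x| ≤ M * weightA₁₃ θ hP 0 g₀ os K s x)) :
    ∀ (F : T4Family) (θ : Stage13HParams F 2) (hP : θ.Provisos₁₃CoPH F 2), (θ.ZhUnity F 2 ∧ θ.SlotsNondegenerate₁₃ F 2) → θ.Admissible F 2 →
      ∀ (g₀ : ℕ → ℝ) (os : List (ULoop F)),
        letI : DecidableEq (Σ K, SiteSeqKey F (0 + K)) := Classical.decEq _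
        ∃ (shA shB : ℕ → ℝ → (Σ K, SiteSeqKey F (0 + K)) → ℝ) (Wsh δ : ℕ → ℝ),
          HybridNE7 1 (F.side ^ 4) (classSet₁₃ θ 0 g₀) (weightA₁₃ θ hP 0 g₀ os) (weightB₁₃ θ hP 0 g₀ os) (fun _ _ => ∅) (fun _ => 0) shA shB Wsh δ := by
  intro F θ hP hG hθ g₀ os
  letI : DecidableEq (Σ K, SiteSeqKey F (0 + K)) := Classical.decEq _
  obtain ⟨A', B', η, R₁, M, hdA, hdB, hlv2, hη0, hηs, hH, hR, hRs, hM, hcur⟩ := hE F θ hP hG hθ g₀ os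
  have hlv := hlive F θ hP hG hθ
  obtain ⟨hA0, hB0⟩ := weights_nonneg θ hP g₀ os
  have hZ := dictionary_of_liveLine θ hP hlv g₀ os
  obtain ⟨η', Wsh, shA, shB, -, -, -, hNE7⟩ :=
    exists_hybridNE7_of_affinityDefectLetter_response_boundedCurrent_of_nonneg (l₀ := 1) (vol := F.side ^ 4)
      (T := classSet₁₃ θ 0 g₀) (A := weightA₁₃ θ hP 0 g₀ os) (B := weightB₁₃ θ hP 0 g₀ os)
      (Z := fun K t => T4GenFunBounds.schemeZ ((datumOfRecord₁₃CoPH F 2 θ hP).scheme g₀) os (0 + K) t)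
      zero_le_one (pow_pos F.side_pos 4) hA0 hB0 hlv2 (fun K t _ => (hZ K t).1) (fun K t _ => (hZ K t).2) hdA hdB
      ⟨η, hη0, hηs, hH⟩ hM hR hRs hcur
  exact ⟨shA, shB, Wsh, _, hNE7⟩

/-- **★ (L) IS NECESSARY AT THE RECORD** — ANY keyed no-bad-class hybrid certificate (13U's `hH`) + the keyed live line ⇒ at every guarded admissible tuple, `(g₀, os)`,
step `K` and source `|t| ≤ 1` SOME σ-key of `classSet₁₃ θ 0 g₀ K` is live under BOTH runs (CLAIM-2's `twoSided_of_hybridNE7` with §1's non-negativity and totals).  So the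
letter (L) of `hE` costs nothing: every road into 13U's socket pays it. [bookkeeping] -/
theorem twoSidedKeyed_of_keyedHybridNE7NoBad_of_liveLine
    (hlive : ∀ (F : T4Family) (θ : Stage13HParams F 2), θ.Provisos₁₃CoPH F 2 → (θ.ZhUnity F 2 ∧ θ.SlotsNondegenerate₁₃ F 2) → θ.Admissible F 2 →
      LiveSel F θ ∧ ZetaMeasurable F 2 θ.ζ)
    (hH : ∀ (F : T4Family) (θ : Stage13HParams F 2) (hP : θ.Provisos₁₃CoPH F 2), (θ.ZhUnity F 2 ∧ θ.SlotsNondegenerate₁₃ F 2) → θ.Admissible F 2 →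
      ∀ (g₀ : ℕ → ℝ) (os : List (ULoop F)),
        letI : DecidableEq (Σ K, SiteSeqKey F (0 + K)) := Classical.decEq _
        ∃ (shA shB : ℕ → ℝ → (Σ K, SiteSeqKey F (0 + K)) → ℝ) (Wsh δ : ℕ → ℝ),
          HybridNE7 1 (F.side ^ 4) (classSet₁₃ θ 0 g₀) (weightA₁₃ θ hP 0 g₀ os) (weightB₁₃ θ hP 0 g₀ os) (fun _ _ => ∅) (fun _ => 0) shA shB Wsh δ) :
    ∀ (F : T4Family) (θ : Stage13HParams F 2) (hP : θ.Provisos₁₃CoPH F 2), (θ.ZhUnity F 2 ∧ θ.SlotsNondegenerate₁₃ F 2) → θ.Admissible F 2 →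
      ∀ (g₀ : ℕ → ℝ) (os : List (ULoop F)) (K : ℕ) (t : ℝ), |t| ≤ 1 →
        ∃ x ∈ classSet₁₃ θ 0 g₀ K, 0 < weightA₁₃ θ hP 0 g₀ os K t x ∧ 0 < weightB₁₃ θ hP 0 g₀ os K t x := by
  intro F θ hP hG hθ g₀ os
  letI : DecidableEq (Σ K, SiteSeqKey F (0 + K)) := Classical.decEq _
  obtain ⟨shA, shB, Wsh, δ, h⟩ := hH F θ hP hG hθ g₀ os
  have hZ := totals_pos_of_liveLine θ hP (hlive F θ hP hG hθ) g₀ os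
  exact twoSided_of_hybridNE7 h (weights_nonneg θ hP g₀ os).1 (weights_nonneg θ hP g₀ os).2 (fun K t _ => (hZ K t).1) fun K t _ => (hZ K t).2

end Socket

/-! ## §3 Hence K3⁸ v6 stub 2's text, and K3⁸ by name modulo stub 1's text [13U BY NAME] -/

section Texts

/-- **★★★ K3⁸ v6 STUB 2's TEXT FROM THE HELLINGER ROAD's PER-TUPLE ENDPOINT LETTERS AND THE KEYED LIVE LINE** — §2's socket fed to dag-n20-w3's 13U
`stubExpansion13HVText_of_keyedHybridNE7NoBad_of_liveLine`: witness `(jc, sh, cr) := (0, the certificate's shells, crOfRecord₁₃V 0 sh⋆)` (13U's construction).  The rates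
hypothesis `KeyedRatesHolderD4V` and the N16 guard are UNREAD.  NOT a proof of `stub_expansion13HV`: `hE` (the two-run content at the class weights of record) and `hlive`
are HYPOTHESES inhabited for no tuple (K0⁷ OPEN). [bookkeeping] -/
theorem stubExpansion13HVText_of_endpointLettersKeyed_of_liveLine
    (hlive : ∀ (F : T4Family) (θ : Stage13HParams F 2), θ.Provisos₁₃CoPH F 2 → (θ.ZhUnity F 2 ∧ θ.SlotsNondegenerate₁₃ F 2) → θ.Admissible F 2 →
      LiveSel F θ ∧ ZetaMeasurable F 2 θ.ζ)
    (hE : ∀ (F : T4Family) (θ : Stage13HParams F 2) (hP : θ.Provisos₁₃CoPH F 2), (θ.ZhUnity F 2 ∧ θ.SlotsNondegenerate₁₃ F 2) → θ.Admissible F 2 →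
      ∀ (g₀ : ℕ → ℝ) (os : List (ULoop F)),
        ∃ (A' B' : ℕ → ℝ → (Σ K, SiteSeqKey F (0 + K)) → ℝ) (η R₁ : ℕ → ℝ) (χ : ℝ) (m : ℕ → ℝ → ℝ),
          (∀ (K : ℕ) (s : ℝ), |s| ≤ 1 → ∀ x ∈ classSet₁₃ θ 0 g₀ K, HasDerivAt (fun u => weightA₁₃ θ hP 0 g₀ os K u x) (A' K s x) s) ∧
          (∀ (K : ℕ) (s : ℝ), |s| ≤ 1 → ∀ x ∈ classSet₁₃ θ 0 g₀ K, HasDerivAt (fun u => weightB₁₃ θ hP 0 g₀ os K u x) (B' K s x) s) ∧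
          (∀ (K : ℕ) (t : ℝ), |t| ≤ 1 → ∃ x ∈ classSet₁₃ θ 0 g₀ K, 0 < weightA₁₃ θ hP 0 g₀ os K t x ∧ 0 < weightB₁₃ θ hP 0 g₀ os K t x) ∧
          (∀ K, 0 ≤ η K) ∧ Summable (fun K => Real.sqrt (η K)) ∧
          (∀ (K : ℕ) (t : ℝ), |t| ≤ 1 →
            1 - ∑ x ∈ classSet₁₃ θ 0 g₀ K, Real.sqrt ((weightA₁₃ θ hP 0 g₀ os K t x / ∑ y ∈ classSet₁₃ θ 0 g₀ K, weightA₁₃ θ hP 0 g₀ os K t y)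
              * (weightB₁₃ θ hP 0 g₀ os K t x / ∑ y ∈ classSet₁₃ θ 0 g₀ K, weightB₁₃ θ hP 0 g₀ os K t y)) ≤ η K) ∧
          (∀ (K : ℕ) (s : ℝ), |s| ≤ 1 →
            |∑ x ∈ classSet₁₃ θ 0 g₀ K, weightB₁₃ θ hP 0 g₀ os K s x / (∑ y ∈ classSet₁₃ θ 0 g₀ K, weightB₁₃ θ hP 0 g₀ os K s y)
              * (B' K s x / weightB₁₃ θ hP 0 g₀ os K s x - A' K s x / weightA₁₃ θ hP 0 g₀ os K s x)| ≤ R₁ K) ∧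
          Summable R₁ ∧
          (∀ (K : ℕ) (s : ℝ), |s| ≤ 1 →
            ∑ x ∈ classSet₁₃ θ 0 g₀ K, (weightA₁₃ θ hP 0 g₀ os K s x / (∑ y ∈ classSet₁₃ θ 0 g₀ K, weightA₁₃ θ hP 0 g₀ os K s y)
              + weightB₁₃ θ hP 0 g₀ os K s x / (∑ y ∈ classSet₁₃ θ 0 g₀ K, weightB₁₃ θ hP 0 g₀ os K s y)) / 2
              * (A' K s x / weightA₁₃ θ hP 0 g₀ os K s x - m K s) ^ 2 ≤ χ)) :
    ∀ β : ℝ, 2 / 3 < β → β < 1 →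
      ∀ (𝔯 : RateReading₁₃CoPH 2) (ksel : RunSel) (ℓ : LetterReading) (ℓ₃ : T4Family → Node00.NE3Letters₁₁) (g B : T4Family → ℝ),
        GuardedReadingN16 𝔯 ksel ℓ ℓ₃ g B → KeyedRatesHolderD4V β (rrOfRecord 𝔯 ksel) →
        ∃ (jc : CutReading) (sh : ShellSplit₁₃CoPH 2 0) (cr : SpineReading), PinnedAtLive jc sh cr ∧
          KeyedRelWeight cr ∧ KeyedShellWeight cr ∧ KeyedExtractionV cr ∧ KeyedCoreEdgeHolderD4V β cr (rrOfRecord 𝔯 ksel) :=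
  stubExpansion13HVText_of_keyedHybridNE7NoBad_of_liveLine (keyedHybridNE7NoBad_of_endpointLettersKeyed_of_liveLine hlive hE) hlive

/-- **★★ K3⁸ BY NAME MODULO STUB 1's v6 TEXT, FROM THE HELLINGER ROAD**: stub 1's registered v6 text + the per-tuple endpoint letters + the keyed live line ⇒
`Theses.BalabanUVNodes.SpineGivenEndpointR13SepCoPHV` (13U's `spineGivenEndpointR13SepCoPHV_of_stubRates13HVText_of_keyedHybridNE7NoBad_of_liveLine`).  NOT a proof of K3⁸:
all three inputs are HYPOTHESES inhabited for no tuple; the audit records `proof.conditional`; nothing is credited. [bookkeeping] -/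
theorem spineGivenEndpointR13SepCoPHV_of_stubRates13HVText_of_endpointLettersKeyed_of_liveLine
    (h₁ : ∃ β : ℝ, 2 / 3 < β ∧ β < 1 ∧
      ∃ (𝔯 : RateReading₁₃CoPH 2) (ksel : RunSel) (ℓ : LetterReading) (ℓ₃ : T4Family → Node00.NE3Letters₁₁) (g B : T4Family → ℝ),
        GuardedReadingN16 𝔯 ksel ℓ ℓ₃ g B ∧ KeyedRatesHolderD4V β (rrOfRecord 𝔯 ksel))
    (hlive : ∀ (F : T4Family) (θ : Stage13HParams F 2), θ.Provisos₁₃CoPH F 2 → (θ.ZhUnity F 2 ∧ θ.SlotsNondegenerate₁₃ F 2) → θ.Admissible F 2 →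
      LiveSel F θ ∧ ZetaMeasurable F 2 θ.ζ)
    (hE : ∀ (F : T4Family) (θ : Stage13HParams F 2) (hP : θ.Provisos₁₃CoPH F 2), (θ.ZhUnity F 2 ∧ θ.SlotsNondegenerate₁₃ F 2) → θ.Admissible F 2 →
      ∀ (g₀ : ℕ → ℝ) (os : List (ULoop F)),
        ∃ (A' B' : ℕ → ℝ → (Σ K, SiteSeqKey F (0 + K)) → ℝ) (η R₁ : ℕ → ℝ) (χ : ℝ) (m : ℕ → ℝ → ℝ),
          (∀ (K : ℕ) (s : ℝ), |s| ≤ 1 → ∀ x ∈ classSet₁₃ θ 0 g₀ K, HasDerivAt (fun u => weightA₁₃ θ hP 0 g₀ os K u x) (A' K s x) s) ∧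
          (∀ (K : ℕ) (s : ℝ), |s| ≤ 1 → ∀ x ∈ classSet₁₃ θ 0 g₀ K, HasDerivAt (fun u => weightB₁₃ θ hP 0 g₀ os K u x) (B' K s x) s) ∧
          (∀ (K : ℕ) (t : ℝ), |t| ≤ 1 → ∃ x ∈ classSet₁₃ θ 0 g₀ K, 0 < weightA₁₃ θ hP 0 g₀ os K t x ∧ 0 < weightB₁₃ θ hP 0 g₀ os K t x) ∧
          (∀ K, 0 ≤ η K) ∧ Summable (fun K => Real.sqrt (η K)) ∧
          (∀ (K : ℕ) (t : ℝ), |t| ≤ 1 →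
            1 - ∑ x ∈ classSet₁₃ θ 0 g₀ K, Real.sqrt ((weightA₁₃ θ hP 0 g₀ os K t x / ∑ y ∈ classSet₁₃ θ 0 g₀ K, weightA₁₃ θ hP 0 g₀ os K t y)
              * (weightB₁₃ θ hP 0 g₀ os K t x / ∑ y ∈ classSet₁₃ θ 0 g₀ K, weightB₁₃ θ hP 0 g₀ os K t y)) ≤ η K) ∧
          (∀ (K : ℕ) (s : ℝ), |s| ≤ 1 →
            |∑ x ∈ classSet₁₃ θ 0 g₀ K, weightB₁₃ θ hP 0 g₀ os K s x / (∑ y ∈ classSet₁₃ θ 0 g₀ K, weightB₁₃ θ hP 0 g₀ os K s y)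
              * (B' K s x / weightB₁₃ θ hP 0 g₀ os K s x - A' K s x / weightA₁₃ θ hP 0 g₀ os K s x)| ≤ R₁ K) ∧
          Summable R₁ ∧
          (∀ (K : ℕ) (s : ℝ), |s| ≤ 1 →
            ∑ x ∈ classSet₁₃ θ 0 g₀ K, (weightA₁₃ θ hP 0 g₀ os K s x / (∑ y ∈ classSet₁₃ θ 0 g₀ K, weightA₁₃ θ hP 0 g₀ os K s y)
              + weightB₁₃ θ hP 0 g₀ os K s x / (∑ y ∈ classSet₁₃ θ 0 g₀ K, weightB₁₃ θ hP 0 g₀ os K s y)) / 2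
              * (A' K s x / weightA₁₃ θ hP 0 g₀ os K s x - m K s) ^ 2 ≤ χ)) :
    Summit.QuantumFields.YangMills.Theses.BalabanUVNodes.SpineGivenEndpointR13SepCoPHV :=
  spineGivenEndpointR13SepCoPHV_of_stubRates13HVText_of_keyedHybridNE7NoBad_of_liveLine h₁ (keyedHybridNE7NoBad_of_endpointLettersKeyed_of_liveLine hlive hE) hlive

/-- **★★ K3⁸ BY NAME MODULO STUB 1's v6 TEXT, BOUNDED-CURRENT EDITION** — as above with (R‑c) replaced by a bounded run-A current.  NOT a proof of K3⁸. [bookkeeping] -/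
theorem spineGivenEndpointR13SepCoPHV_of_stubRates13HVText_of_endpointLettersBoundedCurrentKeyed_of_liveLine
    (h₁ : ∃ β : ℝ, 2 / 3 < β ∧ β < 1 ∧
      ∃ (𝔯 : RateReading₁₃CoPH 2) (ksel : RunSel) (ℓ : LetterReading) (ℓ₃ : T4Family → Node00.NE3Letters₁₁) (g B : T4Family → ℝ),
        GuardedReadingN16 𝔯 ksel ℓ ℓ₃ g B ∧ KeyedRatesHolderD4V β (rrOfRecord 𝔯 ksel))
    (hlive : ∀ (F : T4Family) (θ : Stage13HParams F 2), θ.Provisos₁₃CoPH F 2 → (θ.ZhUnity F 2 ∧ θ.SlotsNondegenerate₁₃ F 2) → θ.Admissible F 2 →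
      LiveSel F θ ∧ ZetaMeasurable F 2 θ.ζ)
    (hE : ∀ (F : T4Family) (θ : Stage13HParams F 2) (hP : θ.Provisos₁₃CoPH F 2), (θ.ZhUnity F 2 ∧ θ.SlotsNondegenerate₁₃ F 2) → θ.Admissible F 2 →
      ∀ (g₀ : ℕ → ℝ) (os : List (ULoop F)),
        ∃ (A' B' : ℕ → ℝ → (Σ K, SiteSeqKey F (0 + K)) → ℝ) (η R₁ : ℕ → ℝ) (M : ℝ),
          (∀ (K : ℕ) (s : ℝ), |s| ≤ 1 → ∀ x ∈ classSet₁₃ θ 0 g₀ K, HasDerivAt (fun u => weightA₁₃ θ hP 0 g₀ os K u x) (A' K s x) s) ∧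
          (∀ (K : ℕ) (s : ℝ), |s| ≤ 1 → ∀ x ∈ classSet₁₃ θ 0 g₀ K, HasDerivAt (fun u => weightB₁₃ θ hP 0 g₀ os K u x) (B' K s x) s) ∧
          (∀ (K : ℕ) (t : ℝ), |t| ≤ 1 → ∃ x ∈ classSet₁₃ θ 0 g₀ K, 0 < weightA₁₃ θ hP 0 g₀ os K t x ∧ 0 < weightB₁₃ θ hP 0 g₀ os K t x) ∧
          (∀ K, 0 ≤ η K) ∧ Summable (fun K => Real.sqrt (η K)) ∧
          (∀ (K : ℕ) (t : ℝ), |t| ≤ 1 →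
            1 - ∑ x ∈ classSet₁₃ θ 0 g₀ K, Real.sqrt ((weightA₁₃ θ hP 0 g₀ os K t x / ∑ y ∈ classSet₁₃ θ 0 g₀ K, weightA₁₃ θ hP 0 g₀ os K t y)
              * (weightB₁₃ θ hP 0 g₀ os K t x / ∑ y ∈ classSet₁₃ θ 0 g₀ K, weightB₁₃ θ hP 0 g₀ os K t y)) ≤ η K) ∧
          (∀ (K : ℕ) (s : ℝ), |s| ≤ 1 →
            |∑ x ∈ classSet₁₃ θ 0 g₀ K, weightB₁₃ θ hP 0 g₀ os K s x / (∑ y ∈ classSet₁₃ θ 0 g₀ K, weightB₁₃ θ hP 0 g₀ os K s y)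
              * (B' K s x / weightB₁₃ θ hP 0 g₀ os K s x - A' K s x / weightA₁₃ θ hP 0 g₀ os K s x)| ≤ R₁ K) ∧
          Summable R₁ ∧ 0 ≤ M ∧
          (∀ (K : ℕ) (s : ℝ), |s| ≤ 1 → ∀ x ∈ classSet₁₃ θ 0 g₀ K, |A' K s x| ≤ M * weightA₁₃ θ hP 0 g₀ os K s x)) :
    Summit.QuantumFields.YangMills.Theses.BalabanUVNodes.SpineGivenEndpointR13SepCoPHV :=
  spineGivenEndpointR13SepCoPHV_of_stubRates13HVText_of_keyedHybridNE7NoBad_of_liveLine h₁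
    (keyedHybridNE7NoBad_of_endpointLettersBoundedCurrentKeyed_of_liveLine hlive hE) hlive

end Texts

end Summit.QuantumFields.YangMills.BalabanUVNodes.N20HellingerRoadKeyedAtRecord

end
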